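import Literature.NumberTheory.PAdicHodge.SenHDescentGL
import Literature.NumberTheory.PAdicHodge.SenDecompletionCocycle
import Literature.NumberTheory.PAdicHodge.SenFiniteVectorsBase
import HarnessLib

/-!
# Sen's theorem in cocycle form at the base of the cyclotomic tower (Berger–Colmez, Prop. 3.2.6)

Notation as in `TateInvariantsBase`: `K₀ = PadicBase F p hp ≅ ℚ_p`, `G₀ = Gal(F̄/K₀)` (`BaseGaloisGroup hp`)
acting on `ℂ_F`, `H₀ = ker χ`, `K n = K₀(ζ_{pⁿ})`, `X = \widehat{K_∞} = ℂ_F^{H₀}`, `γ_n = TateTrace.gen n`.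

* ★★ `TateTrace.baseGalois_GL_cocycle_descends` — **Sen's method for `GL_d` over `K₀`, unconditionally.**
  For every `n ≥ 2` there is `s₀ > 0` such that: if `σ ↦ U_σ : G₀ → M_d(ℂ_F)` is a continuous `1`-cocycle
  (`U_{στ} = U_σ σ(U_τ)`) with `‖U_σ − 1‖ ≤ s₀` entrywise for all `σ ∈ G₀`, then there is `M ∈ GL_d(ℂ_F)`
  with `‖M − 1‖ ≤ |p|²` such that the cohomologous cocycle `V_σ = M⁻¹ U_σ σ(M)` is TRIVIAL on `H₀` and takes
  values in `GL_d(K_n)` (`V_σ ∈ M_d(K_n) ⊆ M_d(ℂ_F)` for every `σ ∈ G₀`). In the language of semilinear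
  representations: a `ℂ_F`-semilinear `G₀`-representation `W` admitting a basis in which the matrices of all
  `σ ∈ G₀` are `s₀`-close to `1` has a basis of `H₀`-invariant vectors on which `G₀` acts through
  `Γ = G₀/H₀` by matrices in `GL_d(K_n)` — Sen's `D_Sen(W)`.

Assembly of the tree's two halves of Sen's method: the `H`-descent `TateSen.baseKer_GL_exists_conj_eq_one`
((TS1), Berger–Colmez Cor. 3.2.2, with Tate's Prop. 9 discharged) and the decompletion along `Γ`
`TateTrace.exists_matrix_conj_fixed_forall` ((TS2)+(TS3), Berger–Colmez Cor. 3.2.4 + Lemme 3.2.5), glued by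
the cocycle identities of Berger–Colmez Prop. 3.2.6 (a cocycle trivial on the normal subgroup `H₀` is
`H₀`-invariant, and `U_γ γ(U_τ) = U_τ τ(U_γ)` since `Γ` is abelian) and Ax–Sen–Tate (`fixedPoints_eq_X`),
`X^{γ_n} = K_n` (`mem_image_K_of_gen_smul_eq`). Everything is proved; no named facts.

References: Berger–Colmez, Astérisque 319 (2008), Prop. 3.2.6 [BergerColmez2008]; S. Sen, Invent. Math. 62
(1980), Thm. 1–2 [Sen1980]; Brinon–Conrad, CMI notes (2009), Thm. 15.1.2 [BrinonConrad2009].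
-/

noncomputable section

open ValuativeRel Field UniformSpace Filter Topology Finset

open scoped IntermediateField

namespace Literature.NumberTheory.PAdicHodge

open Literature.NumberTheory.GaloisRepresentations
open Literature.NumberTheory.GaloisRepresentations.IsNonarchimedeanLocalField
open CyclotomicTower

variable {F : Type} [Field F] [ValuativeRel F] [TopologicalSpace F] [IsNonarchimedeanLocalField F]
  [CharZero F] {p : ℕ} [Fact p.Prime] (hp : valuation F p < 1)

namespace TateTrace

variable {m : Type} [Fintype m] [DecidableEq m]

/-! ### Toolkit -/

omit [CharZero F] [DecidableEq m] in
/-- Entrywise bounds are submultiplicative (`ℂ_F` is ultrametric). [folklore] -/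
private theorem norm_mul_apply_le {A B : Matrix m m (CompletedAlgClosure F)} {a b : ℝ} (ha : 0 ≤ a)
    (hb : 0 ≤ b) (hA : ∀ i j, ‖A i j‖ ≤ a) (hB : ∀ i j, ‖B i j‖ ≤ b) (i j : m) :
    ‖(A * B) i j‖ ≤ a * b := by
  rw [Matrix.mul_apply]
  exact IsUltrametricDist.norm_sum_le_of_forall_le_of_nonneg (mul_nonneg ha hb)
    fun k _ => by rw [norm_mul]; exact mul_le_mul (hA i k) (hB k j) (norm_nonneg _) ha

omit [CharZero F] [Fintype m] [DecidableEq m] in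
/-- `‖(A + B) i j‖ ≤ max`. [folklore] -/
private theorem norm_add_apply_le {A B : Matrix m m (CompletedAlgClosure F)} {a b : ℝ}
    (hA : ∀ i j, ‖A i j‖ ≤ a) (hB : ∀ i j, ‖B i j‖ ≤ b) (i j : m) : ‖(A + B) i j‖ ≤ max a b := by
  rw [Matrix.add_apply]
  exact (IsUltrametricDist.norm_add_le_max _ _).trans (max_le_max (hA i j) (hB i j))

omit [CharZero F] [Fintype m] [DecidableEq m] in
/-- `‖(A - B) i j‖ ≤ max`. [folklore] -/
private theorem norm_sub_apply_le {A B : Matrix m m (CompletedAlgClosure F)} {a b : ℝ}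
    (hA : ∀ i j, ‖A i j‖ ≤ a) (hB : ∀ i j, ‖B i j‖ ≤ b) (i j : m) : ‖(A - B) i j‖ ≤ max a b := by
  rw [sub_eq_add_neg]
  exact norm_add_apply_le hA (fun i j => by rw [Matrix.neg_apply, norm_neg]; exact hB i j) i j

omit [CharZero F] [Fintype m] in
/-- Entries of `B` with `‖B − 1‖ ≤ r ≤ 1` have norm `≤ 1`. [folklore] -/
private theorem norm_apply_le_one_of_norm_sub_one_le {B : Matrix m m (CompletedAlgClosure F)} {r : ℝ}
    (hr1 : r ≤ 1) (hB : ∀ i j, ‖(B - 1) i j‖ ≤ r) (i j : m) : ‖B i j‖ ≤ 1 := by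
  have h : B i j = (B - 1) i j + (1 : Matrix m m (CompletedAlgClosure F)) i j := by
    rw [Matrix.sub_apply, sub_add_cancel]
  rw [h]
  refine (IsUltrametricDist.norm_add_le_max _ _).trans (max_le ((hB i j).trans hr1) ?_)
  rw [Matrix.one_apply]
  split_ifs
  · rw [norm_one]
  · rw [norm_zero]; exact zero_le_one

omit [DecidableEq m] in
/-- Products of matrices over `X` are over `X`. [folklore] -/
private theorem mul_apply_mem_X {A B : Matrix m m (CompletedAlgClosure F)} (hA : ∀ i j, A i j ∈ X hp)
    (hB : ∀ i j, B i j ∈ X hp) (i j : m) : (A * B) i j ∈ X hp := by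
  rw [Matrix.mul_apply]
  exact sum_mem_X hp _ _ fun k _ => mul_mem_X hp (hA i k) (hB k j)

omit [Fintype m] [DecidableEq m] in
/-- `G₀`-images of matrices over `X` are over `X`. [folklore] -/
private theorem map_smul_apply_mem_X (g : BaseGaloisGroup hp) {A : Matrix m m (CompletedAlgClosure F)}
    (hA : ∀ i j, A i j ∈ X hp) (i j : m) : (A.map fun x => g • x) i j ∈ X hp := by
  rw [Matrix.map_apply]; exact smul_mem_X hp g (hA i j)

omit [Fintype m] in
/-- `g(1) = 1`. [folklore] -/
private theorem map_one_base_smul (g : BaseGaloisGroup hp) :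
    ((1 : Matrix m m (CompletedAlgClosure F)).map fun x => g • x) = 1 := by
  set f : CompletedAlgClosure F →+* CompletedAlgClosure F :=
    MulSemiringAction.toRingHom (BaseGaloisGroup hp) (CompletedAlgClosure F) g with hf_def
  have hf : (fun x : CompletedAlgClosure F => g • x) = ⇑f := by funext x; simp [hf_def]
  rw [hf, Matrix.map_one f (map_zero f) (map_one f)]

/-- The conjugate `σ ↦ P⁻¹ U_σ σ(P)` of a cocycle is a cocycle. [folklore] -/
private theorem cocycle_conj' {U : BaseGaloisGroup hp → Matrix m m (CompletedAlgClosure F)}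
    (hU : ∀ g h, U (g * h) = U g * (U h).map fun x => g • x) {P : Matrix m m (CompletedAlgClosure F)}
    (hP : IsUnit P.det) (g h : BaseGaloisGroup hp) :
    P⁻¹ * U (g * h) * P.map (fun x => (g * h) • x) =
      (P⁻¹ * U g * P.map fun x => g • x) * (P⁻¹ * U h * P.map fun x => h • x).map fun x => g • x := by
  set f : CompletedAlgClosure F →+* CompletedAlgClosure F :=
    MulSemiringAction.toRingHom (BaseGaloisGroup hp) (CompletedAlgClosure F) g with hf_def
  have hf : (fun x : CompletedAlgClosure F => g • x) = ⇑f := by funext x; simp [hf_def]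
  have hcancel : P.map ⇑f * P⁻¹.map ⇑f = 1 := by
    rw [← Matrix.map_mul, Matrix.mul_nonsing_inv P hP, Matrix.map_one f (map_zero f) (map_one f)]
  have hmm : ((P.map fun x => h • x).map fun x => g • x) = P.map fun x => (g * h) • x := by
    rw [Matrix.map_map]
    congr 1
    funext x
    exact (mul_smul g h x).symm
  rw [hU g h, ← hmm, hf, Matrix.map_mul, Matrix.map_mul]
  calc P⁻¹ * (U g * (U h).map ⇑f) * ((P.map fun x => h • x).map ⇑f)
      = P⁻¹ * U g * 1 * (U h).map ⇑f * (P.map fun x => h • x).map ⇑f := by noncomm_ring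
    _ = P⁻¹ * U g * (P.map ⇑f * P⁻¹.map ⇑f) * (U h).map ⇑f * (P.map fun x => h • x).map ⇑f := by
        rw [hcancel]
    _ = P⁻¹ * U g * P.map ⇑f * (P⁻¹.map ⇑f * (U h).map ⇑f * (P.map fun x => h • x).map ⇑f) := by
        noncomm_ring

/-! ### Sen's theorem, cocycle form -/

/-- ★★ **Sen's method for `GL_d` over `K₀ ≅ ℚ_p`, unconditionally (Berger–Colmez Prop. 3.2.6 with
`G = G₀`).** For `n ≥ 2` there is `s₀ > 0` (namely `|p|⁷ / K`, `K` the (TS1) constant) such that every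
continuous `1`-cocycle `σ ↦ U_σ : G₀ → M_d(ℂ_F)` (`U_{στ} = U_σ σ(U_τ)`, entrywise action) with
`‖U_σ − 1‖ ≤ s₀` entrywise for all `σ` admits `M ∈ GL_d(ℂ_F)` with `‖M − 1‖ ≤ |p|²` such that
`V_σ = M⁻¹ U_σ σ(M)` satisfies: `V_τ = 1` for `τ ∈ H₀ = ker χ`, and every `V_σ` (`σ ∈ G₀`) has all its
entries in `K_n = K₀(ζ_{pⁿ}) ⊆ ℂ_F`. [cite: BergerColmez2008, Prop. 3.2.6] [cite: Sen1980, Thm. 1 and Thm. 2]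
[cite: BrinonConrad2009, Thm. 15.1.2] -/
theorem baseGalois_GL_cocycle_descends {n : ℕ} (hn : 2 ≤ n) :
    ∃ s₀ : ℝ, 0 < s₀ ∧ ∀ {m : Type} [Fintype m] [DecidableEq m]
      (U : BaseGaloisGroup hp → Matrix m m (CompletedAlgClosure F)),
      (∀ g h, U (g * h) = U g * (U h).map fun x => g • x) → Continuous U →
      (∀ g i j, ‖(U g - 1) i j‖ ≤ s₀) →
      ∃ M : Matrix m m (CompletedAlgClosure F), IsUnit M.det ∧
        (∀ i j, ‖(M - 1) i j‖ ≤ ‖(p : PadicBase F p hp)‖ ^ 2) ∧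
        (∀ τ : BaseGaloisGroup hp, τ ∈ (BaseGaloisGroup.baseCyclotomicCharacter hp).ker →
          M⁻¹ * U τ * M.map (fun x => τ • x) = 1) ∧
        ∀ (σ : BaseGaloisGroup hp) (i j : m), (M⁻¹ * U σ * M.map fun x => σ • x) i j ∈
          ((↑) : NormedAlgClosure F → CompletedAlgClosure F) '' (K hp n : Set (NormedAlgClosure F)) := by
  obtain ⟨K, hK1, hdesc⟩ := TateSen.baseKer_GL_exists_conj_eq_one hp
  have hK0 : 0 < K := lt_of_lt_of_le one_pos hK1
  set π : ℝ := ‖(p : PadicBase F p hp)‖ with hπ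
  have hπ0 : 0 < π := norm_pos_iff.mpr (by exact_mod_cast (Fact.out : p.Prime).ne_zero)
  have hπ1 : π < 1 := PadicBase.norm_p_lt_one hp
  have hπ7 : π ^ 7 < 1 := pow_lt_one₀ hπ0.le hπ1 (by norm_num)
  have hπ72 : π ^ 7 ≤ π ^ 2 := pow_le_pow_of_le_one hπ0.le hπ1.le (by norm_num)
  have hπ21 : π ^ 2 ≤ 1 := pow_le_one₀ hπ0.le hπ1.le
  refine ⟨π ^ 7 / K, by positivity, ?_⟩
  intro m _ _ U hU hcont hbd
  have hsK : K * (π ^ 7 / K) = π ^ 7 := by field_simp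
  have hs7 : π ^ 7 / K ≤ π ^ 7 := div_le_self (by positivity) hK1
  -- Step 1: `H₀`-descent
  obtain ⟨P, hP1, hPdet, hPH⟩ := hdesc
    (fun τ : (BaseGaloisGroup.baseCyclotomicCharacter hp).ker => U τ)
    (fun g h => hU g h) (hcont.comp continuous_subtype_val) (s := π ^ 7 / K) (by positivity)
    (by rw [hsK]; exact hπ7) (fun g i j => hbd g i j)
  have hP1' : ∀ i j, ‖(P - 1) i j‖ ≤ π ^ 7 := fun i j => (hP1 i j).trans (le_of_eq hsK)
  have hPle : ∀ i j, ‖P i j‖ ≤ 1 := norm_apply_le_one_of_norm_sub_one_le hπ7.le hP1'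
  obtain ⟨-, hPinv1⟩ := isUnit_det_and_norm_inv_sub_one_le (by positivity) hπ7 hP1'
  have hPinvle : ∀ i j, ‖P⁻¹ i j‖ ≤ 1 := norm_apply_le_one_of_norm_sub_one_le hπ7.le hPinv1
  -- Step 2: the `H₀`-trivialised cocycle `U₁`
  set U₁ : BaseGaloisGroup hp → Matrix m m (CompletedAlgClosure F) :=
    fun σ => P⁻¹ * U σ * P.map fun x => σ • x with hU₁
  have hU₁H : ∀ τ, τ ∈ (BaseGaloisGroup.baseCyclotomicCharacter hp).ker → U₁ τ = 1 :=
    fun τ hτ => hPH ⟨τ, hτ⟩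
  have hU₁c : ∀ g h, U₁ (g * h) = U₁ g * (U₁ h).map fun x => g • x :=
    fun g h => cocycle_conj' hp hU hPdet g h
  have hU₁n : ∀ σ i j, ‖(U₁ σ - 1) i j‖ ≤ π ^ 7 := by
    intro σ i j
    set f : CompletedAlgClosure F →+* CompletedAlgClosure F :=
      MulSemiringAction.toRingHom (BaseGaloisGroup hp) (CompletedAlgClosure F) σ with hf_def
    have hf : (fun x : CompletedAlgClosure F => σ • x) = ⇑f := by funext x; simp [hf_def]
    have hid : U₁ σ - 1 = P⁻¹ * ((U σ - 1) * P.map (fun x => σ • x) +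
        ((P - 1).map (fun x => σ • x) - (P - 1))) := by
      show P⁻¹ * U σ * P.map (fun x => σ • x) - 1 = _
      rw [hf, Matrix.map_sub f (map_sub f), Matrix.map_one f (map_zero f) (map_one f)]
      calc P⁻¹ * U σ * P.map ⇑f - 1 = P⁻¹ * U σ * P.map ⇑f - P⁻¹ * P := by
            rw [Matrix.nonsing_inv_mul P hPdet]
        _ = _ := by noncomm_ring
    rw [hid]
    have h1 : ∀ i j, ‖(P.map fun x => σ • x) i j‖ ≤ 1 := fun i j => by
      rw [Matrix.map_apply, CompletedAlgClosure.norm_base_smul]; exact hPle i j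
    have h2 : ∀ i j, ‖((P - 1).map fun x => σ • x) i j‖ ≤ π ^ 7 := fun i j => by
      rw [Matrix.map_apply, CompletedAlgClosure.norm_base_smul]; exact hP1' i j
    have h3 : ∀ i j, ‖((U σ - 1) * P.map (fun x => σ • x) +
        ((P - 1).map (fun x => σ • x) - (P - 1))) i j‖ ≤ π ^ 7 := fun i j => by
      refine (norm_add_apply_le (norm_mul_apply_le (by positivity) zero_le_one (hbd σ) h1)
        (norm_sub_apply_le h2 hP1') i j).trans (max_le ?_ (max_le le_rfl le_rfl))
      rw [mul_one]; exact hs7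
    exact (norm_mul_apply_le zero_le_one (by positivity) hPinvle h3 i j).trans (le_of_eq (one_mul _))
  -- Step 3: `U₁` is `H₀`-invariant, hence `X`-valued (Ax–Sen–Tate)
  have hU₁fix : ∀ τ, τ ∈ (BaseGaloisGroup.baseCyclotomicCharacter hp).ker → ∀ σ,
      ((U₁ σ).map fun x => τ • x) = U₁ σ := by
    intro τ hτ σ
    have h1 : U₁ (τ * σ) = (U₁ σ).map fun x => τ • x := by rw [hU₁c, hU₁H τ hτ, Matrix.one_mul]
    have hmem : σ⁻¹ * τ * σ ∈ (BaseGaloisGroup.baseCyclotomicCharacter hp).ker := by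
      rw [MonoidHom.mem_ker] at hτ ⊢
      rw [map_mul, map_mul, hτ, mul_one, map_inv, inv_mul_cancel]
    have h2 : U₁ (τ * σ) = U₁ σ := by
      have h : τ * σ = σ * (σ⁻¹ * τ * σ) := by group
      rw [h, hU₁c σ, hU₁H _ hmem, map_one_base_smul, Matrix.mul_one]
    exact h1.symm.trans h2
  have hU₁X : ∀ σ i j, U₁ σ i j ∈ X hp := by
    intro σ i j
    rw [← fixedPoints_eq_X hp]
    intro g hg
    have hgk : g ∈ (BaseGaloisGroup.baseCyclotomicCharacter hp).ker :=
      (TateSen.mem_baseKer_iff_forall_smul_zeta hp g).mpr hg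
    have h := congrFun (congrFun (hU₁fix g hgk σ) i) j
    rwa [Matrix.map_apply] at h
  -- Step 4: `U₁(γ) γ(U₁(σ)) = U₁(σ) σ(U₁(γ))` (`Γ` is abelian)
  have hcomm : ∀ σ, U₁ (gen hp n) * ((U₁ σ).map fun x => gen hp n • x) =
      U₁ σ * ((U₁ (gen hp n)).map fun x => σ • x) := by
    intro σ
    rw [← hU₁c, ← hU₁c]
    have hmem : (σ * gen hp n)⁻¹ * (gen hp n * σ) ∈ (BaseGaloisGroup.baseCyclotomicCharacter hp).ker := by
      rw [MonoidHom.mem_ker, map_mul, map_inv, map_mul, map_mul,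
        mul_comm (BaseGaloisGroup.baseCyclotomicCharacter hp (gen hp n)), inv_mul_cancel]
    have h : gen hp n * σ = σ * gen hp n * ((σ * gen hp n)⁻¹ * (gen hp n * σ)) :=
      (mul_inv_cancel_left _ _).symm
    rw [h, hU₁c (σ * gen hp n), hU₁H _ hmem, map_one_base_smul, Matrix.mul_one]
  -- Step 5: decompletion along `γ_n`
  obtain ⟨B, hBX, hB1, hBdet, hBinvX, -, hforall⟩ :=
    exists_matrix_conj_fixed_forall hp hn (hU₁X (gen hp n)) (hU₁n (gen hp n))
  have hBle : ∀ i j, ‖B i j‖ ≤ 1 := norm_apply_le_one_of_norm_sub_one_le hπ21 hB1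
  -- Step 6: `M = P B`
  have hV : ∀ σ, (P * B)⁻¹ * U σ * (P * B).map (fun x => σ • x) = B⁻¹ * U₁ σ * B.map fun x => σ • x := by
    intro σ
    set f : CompletedAlgClosure F →+* CompletedAlgClosure F :=
      MulSemiringAction.toRingHom (BaseGaloisGroup hp) (CompletedAlgClosure F) σ with hf_def
    have hf : (fun x : CompletedAlgClosure F => σ • x) = ⇑f := by funext x; simp [hf_def]
    show _ = B⁻¹ * (P⁻¹ * U σ * P.map fun x => σ • x) * B.map fun x => σ • x
    rw [Matrix.mul_inv_rev, hf, Matrix.map_mul]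
    noncomm_ring
  refine ⟨P * B, ?_, ?_, ?_, ?_⟩
  · rw [Matrix.det_mul]; exact hPdet.mul hBdet
  · intro i j
    have h : P * B - 1 = (P - 1) * B + (B - 1) := by noncomm_ring
    rw [h]
    refine (norm_add_apply_le (norm_mul_apply_le (by positivity) zero_le_one hP1' hBle) hB1 i j).trans
      (max_le ?_ le_rfl)
    rw [mul_one]; exact hπ72
  · intro τ hτ
    have hBfix : (B.map fun x => τ • x) = B := by
      ext i j
      rw [Matrix.map_apply]
      have h := hBX i j
      rw [← fixedPoints_eq_X hp] at h
      exact h τ ((TateSen.mem_baseKer_iff_forall_smul_zeta hp τ).mp hτ)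
    rw [hV, hU₁H τ hτ, Matrix.mul_one, hBfix, Matrix.nonsing_inv_mul B hBdet]
  · intro σ i j
    rw [hV]
    exact mem_image_K_of_gen_smul_eq hp hn
      (mul_apply_mem_X hp (mul_apply_mem_X hp hBinvX (hU₁X σ)) (map_smul_apply_mem_X hp σ hBX) i j)
      (hforall σ (U₁ σ) (hU₁X σ) (hcomm σ) i j)

end TateTrace

end Literature.NumberTheory.PAdicHodge
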